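import Summits.Ventures.DiscreteObjects.Hadamard.NegaPairItoQuadruple
import Summits.Ventures.DiscreteObjects.Hadamard.ItoTypeAut334
import Summits.Ventures.DiscreteObjects.Hadamard.Order167IndexTwoIto668
import Summits.Ventures.DiscreteObjects.Hadamard.ItoMatrix167Iff668

/-!
# H(668): the order-334 line IS Ito's conjecture at t = 167 — seven equivalent forms (kernel TFAE; capstone of the
# 167/334 dictionary at existence level)

Framing: lottery ticket; floor = certified bounds/negative ranges.

Cell pub-namedobj (venture DiscreteObjects), target (H), hadamard gen 23.  The tree held the order-334 census line as a chain
of ONE-WAY kernel results: an automorphism of pair order `334` of a hypothetical `H(668)` yields a negaperiodic complementary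
pair of length `334` (gen 19, `negaPair_of_hadamard668_orderOf_334`); an Ito-type `H(668)` carries an automorphism of pair order
`334` (gen 19, `hadamard668_itoType_aut334`); centraliser index `≥ 2` at an element of order `167` ⇔ an element of pair order
`334` (gen 21, `Order167IndexTwoIto668`); and gen 22's iff `hadamard668_ito_iff_itoMatrix` for the FULL dihedral–quaternion
symmetry `⟨σ₁₆₇⟩ ⋊ V₄` with a fixed-point-free inverting coset.  Gen 23's `NegaPairItoQuadruple` (Balonin–Đoković 2015 §9 in
the kernel: negaperiodic Golay pair of length `2t` ⇔ quasi-Williamson quadruple of order `t`, `t` odd) closes the loop.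
**`hadamard668_order334_tfae`** — the following are equivalent:
1. some Hadamard matrix of order `668` has a signed automorphism of pair order `334`;
2. some Hadamard matrix of order `668` has a signed automorphism `σ` of pair exponent `167`, non-trivial, and a signed
   automorphism commuting with it (pairs) whose pair is a non-trivial involution (centraliser index `≥ 2` over `±⟨σ⟩`);
3. there is a negaperiodic Golay pair of length `334` (antiperiodic form: `±1` sequences `u, v` on `ZMod 668`,
   `u (x + 334) = −u x`, `v (x + 334) = −v x`, `PAF_u(s) + PAF_v(s) = 0` for `s ∉ {0, 334}`);
4. there is a quasi-Williamson quadruple of order `167`: `±1` sequences `a, b, c, d` on `ZMod 167` with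
   `Σ PAF = 0` off `0` and `A Bᵀ + C Dᵀ = B Aᵀ + D Cᵀ` for their circulants;
5. there are `a, b, c, d : ZMod 167 → ℤ` with the Ito-type array `Literature….itoMatrix a b c d` a Hadamard matrix of order
   `668` (Ito's conjecture at `t = 167`; Ito's relative difference sets in the dicyclic group of order `1336`);
6. there is a Hadamard `2 × 2` array of negacyclic `±1` blocks of order `334` (gen 19's form);
7. some Hadamard matrix of order `668` has `σ` of pair exponent `167`, a centralising signed automorphism with non-trivial
   involution pair, and an inverting signed automorphism `ρ` (multiplier `≡ −1`) with `ρ`, `ρτ` fixed-point-free on rows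
   (gen 22's regular `⟨σ⟩ ⋊ V₄` symmetry).
Corollaries: **`hadamard668_order334_iff_itoMatrix`** (1 ⇔ 5), **`hadamard668_centralizer167_index_two_iff_itoMatrix`** (2 ⇔ 5),
**`hadamard668_negaPair_iff_itoMatrix`** (3 ⇔ 5), **`hadamard668_order334_iff_ito_symmetry`** (1 ⇔ 7: at EXISTENCE level an
automorphism of order 334 can be traded for the full Ito symmetry — the inverting element comes for free).
Consequence for the 167-local dictionary (gen 21/22): its index-2 leaves (with or without a block-preserving / fixed-point-free
inverting involution) all have the SAME existence content, Ito's conjecture at `t = 167`; together with gen 22's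
`|N(⟨σ₁₆₇⟩):±⟨σ₁₆₇⟩| = 8 ⇔ classical Williamson`, the census lines at `167·2` are exactly the two classical open problems
(Williamson sequences of length 167 ⊂ Ito-type quadruples of order 167, `WilliamsonImpliesIto167`).  STRUCTURE / DICTIONARY of
a hypothetical object; every item OPEN; no order excluded; H(668) untouched.  Ours; no `sorry`, no definitions, default
heartbeats.
-/

namespace Summit.Ventures.DiscreteObjects.Hadamard

open Finset BigOperators Matrix

open Literature.Combinatorics.Designs.GoethalsSeidel (IsHadamardMatrix circT)
open Literature.Combinatorics.Designs.LegendrePairs (PAF IsPM)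
open Literature.Combinatorics.Designs.ItoArray (itoMatrix ito_isHadamard)

/-- `334 = 2 · 167` as a cast in `ZMod 668` -/
lemma cast_two_mul_167 : ((2 * 167 : ℕ) : ZMod 668) = 334 := by norm_num

/-- **(3) ⇒ (4) at `t = 167`**: a negaperiodic Golay pair of length `334` (antiperiodic form on `ZMod 668`) gives a
quasi-Williamson quadruple of order `167` (`NegaPairItoQuadruple`, Balonin–Đoković 2015 §9). -/
theorem itoQuadruple_of_negaPair668 (u v : ZMod 668 → ℤ) (hu : IsPM u) (hv : IsPM v)
    (hua : ∀ x, u (x + 334) = -u x) (hva : ∀ x, v (x + 334) = -v x)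
    (hp : ∀ s : ZMod 668, s ≠ 0 → s ≠ 334 → PAF u s + PAF v s = 0) :
    ∃ a b c d : ZMod 167 → ℤ, IsPM a ∧ IsPM b ∧ IsPM c ∧ IsPM d ∧
      (∀ r : ZMod 167, r ≠ 0 → PAF a r + PAF b r + PAF c r + PAF d r = 0) ∧
      circulant a * circT b + circulant c * circT d = circulant b * circT a + circulant d * circT c := by
  refine exists_itoQuadruple_of_negaPair (n := 668) (t := 167) (by norm_num) ⟨83, by norm_num⟩ u v hu hv ?_ ?_ ?_
  · rw [cast_two_mul_167]; exact hua
  · rw [cast_two_mul_167]; exact hva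
  · rw [cast_two_mul_167]; exact hp

/-- **(4) ⇒ (3) at `t = 167`** (the elementary converse of `NegaPairItoQuadruple`). -/
theorem negaPair668_of_itoQuadruple (a b c d : ZMod 167 → ℤ) (ha : IsPM a) (hb : IsPM b) (hc : IsPM c) (hd : IsPM d)
    (hs : ∀ r : ZMod 167, r ≠ 0 → PAF a r + PAF b r + PAF c r + PAF d r = 0)
    (hab : circulant a * circT b + circulant c * circT d = circulant b * circT a + circulant d * circT c) :
    ∃ u v : ZMod 668 → ℤ, IsPM u ∧ IsPM v ∧ (∀ x, u (x + 334) = -u x) ∧ (∀ x, v (x + 334) = -v x) ∧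
      ∀ s : ZMod 668, s ≠ 0 → s ≠ 334 → PAF u s + PAF v s = 0 := by
  have h := exists_negaPair_of_itoQuadruple (n := 668) (t := 167) (by norm_num) ⟨83, by norm_num⟩ a b c d ha hb hc hd hs hab
  rw [cast_two_mul_167] at h
  exact h

/-- **The order-334 line of the H(668) automorphism census: seven equivalent forms (kernel TFAE).**  See the module
docstring for the reading of the seven statements. -/
theorem hadamard668_order334_tfae : List.TFAE [
    -- 1: an automorphism of pair order 334
    ∃ (ι : Type) (_ : Fintype ι) (_ : DecidableEq ι) (H : Matrix ι ι ℤ) (π κ : Equiv.Perm ι) (d e : ι → ℤ),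
      Fintype.card ι = 668 ∧ IsHadamardMatrix H ∧ IsSignedAut H π κ d e ∧
      orderOf ((π, κ) : Equiv.Perm ι × Equiv.Perm ι) = 334,
    -- 2: an element of order 167 with a centralising involution (index ≥ 2)
    ∃ (ι : Type) (_ : Fintype ι) (_ : DecidableEq ι) (H : Matrix ι ι ℤ) (π κ π₁ κ₁ : Equiv.Perm ι) (d e d₁ e₁ : ι → ℤ),
      Fintype.card ι = 668 ∧ IsHadamardMatrix H ∧ IsSignedAut H π κ d e ∧ π ^ 167 = 1 ∧ κ ^ 167 = 1 ∧ (π ≠ 1 ∨ κ ≠ 1) ∧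
      IsSignedAut H π₁ κ₁ d₁ e₁ ∧ Commute π₁ π ∧ Commute κ₁ κ ∧ π₁ ^ 2 = 1 ∧ κ₁ ^ 2 = 1 ∧ (π₁ ≠ 1 ∨ κ₁ ≠ 1),
    -- 3: a negaperiodic Golay pair of length 334 (antiperiodic form)
    ∃ u v : ZMod 668 → ℤ, IsPM u ∧ IsPM v ∧ (∀ x, u (x + 334) = -u x) ∧ (∀ x, v (x + 334) = -v x) ∧
      ∀ s : ZMod 668, s ≠ 0 → s ≠ 334 → PAF u s + PAF v s = 0,
    -- 4: a quasi-Williamson quadruple of order 167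
    ∃ a b c d : ZMod 167 → ℤ, IsPM a ∧ IsPM b ∧ IsPM c ∧ IsPM d ∧
      (∀ r : ZMod 167, r ≠ 0 → PAF a r + PAF b r + PAF c r + PAF d r = 0) ∧
      circulant a * circT b + circulant c * circT d = circulant b * circT a + circulant d * circT c,
    -- 5: an Ito-type Hadamard matrix of order 668
    ∃ a b c d : ZMod 167 → ℤ, IsHadamardMatrix (itoMatrix a b c d),
    -- 6: a Hadamard 2 × 2 negacyclic array of order 668
    ∃ x : Fin 2 → Fin 2 → ZMod 668 → ℤ, (∀ p q r, x p q (r + 334) = -x p q r) ∧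
      IsHadamardMatrix (Matrix.of fun (a b : Fin 2 × ZMod 334) => x a.1 b.1 ((b.2.val : ZMod 668) - (a.2.val : ZMod 668))),
    -- 7: gen 22's regular ⟨σ⟩ ⋊ V₄ symmetry
    ∃ (ι : Type) (_ : Fintype ι) (_ : DecidableEq ι) (H : Matrix ι ι ℤ) (π κ π₁ κ₁ π₂ κ₂ : Equiv.Perm ι)
        (d e d₁ e₁ d₂ e₂ : ι → ℤ) (μ : ℕ), Fintype.card ι = 668 ∧ IsHadamardMatrix H ∧ IsSignedAut H π κ d e ∧
        π ^ 167 = 1 ∧ κ ^ 167 = 1 ∧ (π ≠ 1 ∨ κ ≠ 1) ∧ IsSignedAut H π₁ κ₁ d₁ e₁ ∧ Commute π₁ π ∧ Commute κ₁ κ ∧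
        π₁ ^ 2 = 1 ∧ κ₁ ^ 2 = 1 ∧ (π₁ ≠ 1 ∨ κ₁ ≠ 1) ∧ IsSignedAut H π₂ κ₂ d₂ e₂ ∧ π₂ * π = π ^ μ * π₂ ∧
        κ₂ * κ = κ ^ μ * κ₂ ∧ μ % 167 = 166 ∧ (∀ x, π₂ x ≠ x) ∧ (∀ x, (π₂ * π₁) x ≠ x)] := by
  tfae_have 1 → 3 := by
    rintro ⟨ι, _, _, H, π, κ, d, e, hι, hH, haut, hord⟩
    exact negaPair_of_hadamard668_orderOf_334 hH hι π κ d e haut hord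
  tfae_have 3 → 4 := by
    rintro ⟨u, v, hu, hv, hua, hva, hp⟩
    exact itoQuadruple_of_negaPair668 u v hu hv hua hva hp
  tfae_have 4 → 5 := by
    rintro ⟨a, b, c, d, ha, hb, hc, hd, hs, hab⟩
    exact ⟨a, b, c, d, ito_isHadamard a b c d ha hb hc hd hs hab⟩
  tfae_have 5 → 1 := by
    rintro ⟨a, b, c, d, hI⟩
    obtain ⟨σ, s, haut, hcard, hord⟩ := hadamard668_itoType_aut334 a b c d
    exact ⟨Fin 4 × ZMod 167, inferInstance, inferInstance, itoMatrix a b c d, σ, σ, s, s, hcard, hI, haut, hord⟩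
  tfae_have 1 → 2 := by
    rintro ⟨ι, _, _, H, π, κ, d, e, hι, hH, haut, hord⟩
    obtain ⟨hπ, hκ, hne, haut', hcπ, hcκ, h2, h2', hne'⟩ := order334_sq_and_pow167 (H := H) (d := d) (e := e) haut hord
    exact ⟨ι, inferInstance, inferInstance, H, π ^ 2, κ ^ 2, π ^ 167, κ ^ 167, _, _, _, _, hι, hH, isSignedAut_pow haut 2,
      hπ, hκ, hne, haut', hcπ, hcκ, h2, h2', hne'⟩
  tfae_have 2 → 1 := by
    rintro ⟨ι, _, _, H, π, κ, π₁, κ₁, d, e, d₁, e₁, hι, hH, haut, hπ, hκ, hne, haut₁, hcπ, hcκ, h2, h2', hne'⟩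
    exact ⟨ι, inferInstance, inferInstance, H, π₁ * π, κ₁ * κ, _, _, hι, hH, isSignedAut_mul haut₁ haut,
      centralizer167_involution_mul_orderOf hπ hκ hne hcπ hcκ h2 h2' hne'⟩
  tfae_have 1 ↔ 6 := hadamard668_aut334_iff_negacyclicArray
  tfae_have 5 ↔ 7 := hadamard668_ito_iff_itoMatrix.symm
  tfae_finish

/-- **An automorphism of order 334 ⇔ Ito type** (forms 1 ⇔ 5): some Hadamard matrix of order `668` has a signed automorphism
of pair order `334` iff there is an Ito-type quadruple of order `167` (`itoMatrix a b c d` Hadamard). -/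
theorem hadamard668_order334_iff_itoMatrix :
    (∃ (ι : Type) (_ : Fintype ι) (_ : DecidableEq ι) (H : Matrix ι ι ℤ) (π κ : Equiv.Perm ι) (d e : ι → ℤ),
      Fintype.card ι = 668 ∧ IsHadamardMatrix H ∧ IsSignedAut H π κ d e ∧
      orderOf ((π, κ) : Equiv.Perm ι × Equiv.Perm ι) = 334) ↔
    ∃ a b c d : ZMod 167 → ℤ, IsHadamardMatrix (itoMatrix a b c d) :=
  hadamard668_order334_tfae.out 0 4

/-- **Centraliser index ≥ 2 at an element of order 167 ⇔ Ito type** (forms 2 ⇔ 5). -/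
theorem hadamard668_centralizer167_index_two_iff_itoMatrix :
    (∃ (ι : Type) (_ : Fintype ι) (_ : DecidableEq ι) (H : Matrix ι ι ℤ) (π κ π₁ κ₁ : Equiv.Perm ι) (d e d₁ e₁ : ι → ℤ),
      Fintype.card ι = 668 ∧ IsHadamardMatrix H ∧ IsSignedAut H π κ d e ∧ π ^ 167 = 1 ∧ κ ^ 167 = 1 ∧ (π ≠ 1 ∨ κ ≠ 1) ∧
      IsSignedAut H π₁ κ₁ d₁ e₁ ∧ Commute π₁ π ∧ Commute κ₁ κ ∧ π₁ ^ 2 = 1 ∧ κ₁ ^ 2 = 1 ∧ (π₁ ≠ 1 ∨ κ₁ ≠ 1)) ↔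
    ∃ a b c d : ZMod 167 → ℤ, IsHadamardMatrix (itoMatrix a b c d) :=
  hadamard668_order334_tfae.out 1 4

/-- **Negaperiodic Golay pair of length 334 ⇔ Ito-type H(668)** (forms 3 ⇔ 5; Balonin–Đoković 2015 §9 at `t = 167`, kernel). -/
theorem hadamard668_negaPair_iff_itoMatrix :
    (∃ u v : ZMod 668 → ℤ, IsPM u ∧ IsPM v ∧ (∀ x, u (x + 334) = -u x) ∧ (∀ x, v (x + 334) = -v x) ∧
      ∀ s : ZMod 668, s ≠ 0 → s ≠ 334 → PAF u s + PAF v s = 0) ↔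
    ∃ a b c d : ZMod 167 → ℤ, IsHadamardMatrix (itoMatrix a b c d) :=
  hadamard668_order334_tfae.out 2 4

/-- **At existence level an automorphism of order 334 is as strong as the full Ito symmetry** (forms 1 ⇔ 7): if some H(668)
has a signed automorphism of pair order `334`, then some (possibly different) H(668) has `σ₁₆₇`, a centralising involution and
a fixed-point-free inverting coset — the inverting element comes for free. -/
theorem hadamard668_order334_iff_ito_symmetry :
    (∃ (ι : Type) (_ : Fintype ι) (_ : DecidableEq ι) (H : Matrix ι ι ℤ) (π κ : Equiv.Perm ι) (d e : ι → ℤ),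
      Fintype.card ι = 668 ∧ IsHadamardMatrix H ∧ IsSignedAut H π κ d e ∧
      orderOf ((π, κ) : Equiv.Perm ι × Equiv.Perm ι) = 334) ↔
    ∃ (ι : Type) (_ : Fintype ι) (_ : DecidableEq ι) (H : Matrix ι ι ℤ) (π κ π₁ κ₁ π₂ κ₂ : Equiv.Perm ι)
        (d e d₁ e₁ d₂ e₂ : ι → ℤ) (μ : ℕ), Fintype.card ι = 668 ∧ IsHadamardMatrix H ∧ IsSignedAut H π κ d e ∧
        π ^ 167 = 1 ∧ κ ^ 167 = 1 ∧ (π ≠ 1 ∨ κ ≠ 1) ∧ IsSignedAut H π₁ κ₁ d₁ e₁ ∧ Commute π₁ π ∧ Commute κ₁ κ ∧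
        π₁ ^ 2 = 1 ∧ κ₁ ^ 2 = 1 ∧ (π₁ ≠ 1 ∨ κ₁ ≠ 1) ∧ IsSignedAut H π₂ κ₂ d₂ e₂ ∧ π₂ * π = π ^ μ * π₂ ∧
        κ₂ * κ = κ ^ μ * κ₂ ∧ μ % 167 = 166 ∧ (∀ x, π₂ x ≠ x) ∧ (∀ x, (π₂ * π₁) x ≠ x) :=
  hadamard668_order334_tfae.out 0 6

end Summit.Ventures.DiscreteObjects.Hadamard
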